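import Summits.Ventures.PercRepro.S1Kill

/-!
# PercRepro — THE NULLITY SET OF THE TRIANGLES: THE GREEDY CHAIN (p2, gen 22; SUBCLAIM-S1 §6.7)

Adding a triangle `T ⊄ S` to `S` raises the nullity by at least one (submodularity; `S ∩ T ⊊ T` is independent). So
`r` greedily chosen triangles span a set of nullity `≥ r` with `≤ 3r` points; if the chain stops early every triangle
lies in the union and Lemma T on the restriction gives nullity `≥ r` whenever `(r − 1)·r < 2·s₃`. Either way at most
`s₃ − r` triangles lie outside the set.

* `eRk_union_triangle_add_le` — one more triangle, one more unit of nullity;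
* **`exists_nullity_set`** — the set `S` with `|S| ≤ 3r`, `r(S) + r ≤ |S|`, `#{T ⊄ S} + r ≤ s₃`.
Axioms: standard.
-/

open scoped Matroid

namespace PercRepro

namespace S1

open Set

variable {α : Type}

/-- **One more triangle, one more nullity**: for `S ⊆ E` and a triangle `T ⊄ S`, `r(S ∪ T) + (j + 1) ≤ |S ∪ T|` once
`r(S) + j ≤ |S|` (submodularity; `S ∩ T ⊊ T` is independent). -/
theorem eRk_union_triangle_add_le (M : Matroid α) [M.Finite] {S T : Set α} (hS : S ⊆ M.E)
    (hT : M.IsCircuit T ∧ T.ncard = 3) (hTS : ¬ T ⊆ S) {j : ℕ} (hj : M.eRk S + (j : ℕ∞) ≤ (S.ncard : ℕ∞)) :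
    M.eRk (S ∪ T) + ((j + 1 : ℕ) : ℕ∞) ≤ ((S ∪ T).ncard : ℕ∞) := by
  have hEfin : M.E.Finite := M.ground_finite
  have hSfin : S.Finite := hEfin.subset hS
  have hTfin : T.Finite := hEfin.subset hT.1.subset_ground
  have hsub : M.eRk (S ∩ T) + M.eRk (S ∪ T) ≤ M.eRk S + M.eRk T := M.eRk_inter_add_eRk_union_le S T
  have hind : M.Indep (S ∩ T) := hT.1.ssubset_indep ⟨Set.inter_subset_right, fun h => hTS (fun x hx => (h hx).1)⟩
  have hrT : M.eRk T = 2 := by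
    have h := hT.1.eRk_add_one_eq
    rw [← hTfin.cast_ncard_eq, hT.2] at h
    have hne : M.eRk T ≠ ⊤ := ((M.eRk_le_encard _).trans_lt hTfin.encard_lt_top).ne
    obtain ⟨r, hr⟩ := ENat.ne_top_iff_exists.1 hne
    rw [← hr] at h ⊢
    have h' : r + 1 = 3 := by exact_mod_cast h
    have : r = 2 := by omega
    rw [this]; rfl
  have hrI : M.eRk (S ∩ T) = ((S ∩ T).ncard : ℕ∞) := by
    rw [hind.eRk_eq_encard, (hSfin.subset Set.inter_subset_left).cast_ncard_eq]
  -- to naturals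
  have hrS : M.eRk S ≠ ⊤ := ((M.eRk_le_encard S).trans_lt hSfin.encard_lt_top).ne
  obtain ⟨a, ha⟩ := ENat.ne_top_iff_exists.1 hrS
  have hrU : M.eRk (S ∪ T) ≠ ⊤ := ((M.eRk_le_encard _).trans_lt (hSfin.union hTfin).encard_lt_top).ne
  obtain ⟨u, hu⟩ := ENat.ne_top_iff_exists.1 hrU
  rw [← ha, hrI, ← hu, hrT] at hsub
  rw [← ha] at hj
  rw [← hu]
  have hsub' : (S ∩ T).ncard + u ≤ a + 2 := by exact_mod_cast hsub
  have hj' : a + j ≤ S.ncard := by exact_mod_cast hj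
  have hcard : (S ∪ T).ncard + (S ∩ T).ncard = S.ncard + T.ncard := Set.ncard_union_add_ncard_inter S T hSfin hTfin
  have hgoal : u + (j + 1) ≤ (S ∪ T).ncard := by rw [hT.2] at hcard; omega
  exact_mod_cast hgoal

/-- **THE NULLITY SET OF THE TRIANGLES** (the greedy chain): under (C1), for every `r` with `(r − 1)·r < 2·s₃`
there is `S ⊆ E` with `|S| ≤ 3r`, `r(S) + r ≤ |S|` and at most `s₃ − r` triangles not inside `S` — the union of a
greedy chain of `r` triangles, each adding a unit of nullity, or the union of all triangles (then Lemma T on `M ↾ S`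
gives nullity `≥ r`). -/
theorem exists_nullity_set (M : Matroid α) [M.Finite] (hC1 : ∀ L ⊆ M.E, M.eRk L = 2 → L.ncard ≤ 3) (r : ℕ)
    (hr : (r - 1) * r < 2 * (ThmN.triangles M).ncard) :
    ∃ S ⊆ M.E, S.ncard ≤ 3 * r ∧ M.eRk S + (r : ℕ∞) ≤ (S.ncard : ℕ∞) ∧
      {C : Set α | M.IsCircuit C ∧ C.ncard = 3 ∧ ¬ C ⊆ S}.ncard + r ≤ (ThmN.triangles M).ncard := by
  classical
  have hEfin : M.E.Finite := M.ground_finite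
  have htfin : (ThmN.triangles M).Finite := hEfin.finite_subsets.subset (fun C hC => hC.1.subset_ground)
  set 𝒯 := htfin.toFinset with h𝒯
  have hmem𝒯 : ∀ C, C ∈ 𝒯 ↔ M.IsCircuit C ∧ C.ncard = 3 := fun C => by
    rw [h𝒯, Set.Finite.mem_toFinset]; rfl
  have h𝒯card : 𝒯.card = (ThmN.triangles M).ncard := (Set.ncard_eq_toFinset_card _ htfin).symm
  -- the invariant
  set P : ℕ → Prop := fun j => ∃ S ⊆ M.E, S.ncard ≤ 3 * j ∧ M.eRk S + (j : ℕ∞) ≤ (S.ncard : ℕ∞) ∧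
    ∃ 𝒯' ⊆ 𝒯, 𝒯'.card = j ∧ ∀ C ∈ 𝒯', C ⊆ S with hP
  set Q : Prop := ∃ S ⊆ M.E, S.ncard ≤ 3 * r ∧ ∀ C ∈ 𝒯, C ⊆ S with hQ
  have hchain : ∀ j, j ≤ r → P j ∨ Q := by
    intro j
    induction j with
    | zero =>
      intro _
      left
      refine ⟨∅, Set.empty_subset _, by simp, by simp, ∅, Finset.empty_subset _, rfl, by simp⟩
    | succ j ih =>
      intro hjr
      rcases ih (by omega) with ⟨S, hS, hcard, hν, 𝒯', h𝒯'sub, h𝒯'card, h𝒯'in⟩ | hQ'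
      · by_cases hex : ∃ C ∈ 𝒯, ¬ C ⊆ S
        · obtain ⟨C, hC, hCS⟩ := hex
          left
          have hC' := (hmem𝒯 C).1 hC
          have hCfin : C.Finite := hEfin.subset hC'.1.subset_ground
          refine ⟨S ∪ C, Set.union_subset hS hC'.1.subset_ground, ?_, ?_, insert C 𝒯', ?_, ?_, ?_⟩
          · have := Set.ncard_union_le S C
            rw [hC'.2] at this
            omega
          · exact eRk_union_triangle_add_le M hS hC' hCS hν
          · exact Finset.insert_subset hC h𝒯'sub
          · rw [Finset.card_insert_of_notMem (fun h => hCS (h𝒯'in C h)), h𝒯'card]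
          · intro D hD
            rw [Finset.mem_insert] at hD
            rcases hD with rfl | hD
            · exact Set.subset_union_right
            · exact (h𝒯'in D hD).trans Set.subset_union_left
        · right
          push Not at hex
          exact ⟨S, hS, by omega, hex⟩
      · right; exact hQ'
  rcases hchain r le_rfl with ⟨S, hS, hcard, hν, 𝒯', h𝒯'sub, h𝒯'card, h𝒯'in⟩ | ⟨S, hS, hcard, hall⟩
  · refine ⟨S, hS, hcard, hν, ?_⟩
    -- the triangles not inside `S` avoid `𝒯'`
    have hsub : {C : Set α | M.IsCircuit C ∧ C.ncard = 3 ∧ ¬ C ⊆ S} ⊆ ((𝒯 \ 𝒯' : Finset (Set α)) : Set (Set α)) := by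
      intro C hC
      rw [Finset.mem_coe, Finset.mem_sdiff, hmem𝒯]
      exact ⟨⟨hC.1, hC.2.1⟩, fun h => hC.2.2 (h𝒯'in C h)⟩
    have h1 := Set.ncard_le_ncard hsub (Finset.finite_toSet _)
    rw [Set.ncard_coe_finset, Finset.card_sdiff_of_subset h𝒯'sub, h𝒯'card, h𝒯card] at h1
    have h2 : r ≤ (ThmN.triangles M).ncard := by
      rw [← h𝒯card, ← h𝒯'card]; exact Finset.card_le_card h𝒯'sub
    omega
  · -- every triangle inside `S`: Lemma T on `M ↾ S`
    have hSfin : S.Finite := hEfin.subset hS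
    haveI : (M ↾ S).Finite := M.restrict_finite hSfin
    have hrS : M.eRk S ≠ ⊤ := ((M.eRk_le_encard S).trans_lt hSfin.encard_lt_top).ne
    obtain ⟨a, ha⟩ := ENat.ne_top_iff_exists.1 hrS
    have haS : a ≤ S.ncard := by
      have h := M.eRk_le_encard S
      rw [← ha, ← hSfin.cast_ncard_eq] at h
      exact_mod_cast h
    have hd' : (M ↾ S).E.encard = (M ↾ S).eRank + ((S.ncard - a : ℕ) : ℕ∞) := by
      rw [Matroid.restrict_ground_eq, Matroid.eRank_restrict, ← ha, ← hSfin.cast_ncard_eq]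
      norm_cast
      omega
    have hC1' : ∀ L ⊆ (M ↾ S).E, (M ↾ S).eRk L = 2 → L.ncard ≤ 3 := by
      intro L hL hr2
      rw [Matroid.restrict_ground_eq] at hL
      rw [Matroid.restrict_eRk_eq M hL] at hr2
      exact hC1 L (hL.trans hS) hr2
    have hT := two_mul_ncard_triangles_le (M ↾ S) hC1' hd'
    have htri : ThmN.triangles (M ↾ S) = ThmN.triangles M := by
      ext C
      simp only [ThmN.triangles, Set.mem_setOf_eq]
      rw [Matroid.restrict_isCircuit_iff hS]
      constructor
      · rintro ⟨⟨hC, -⟩, h3⟩; exact ⟨hC, h3⟩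
      · rintro ⟨hC, h3⟩; exact ⟨⟨hC, hall C ((hmem𝒯 C).2 ⟨hC, h3⟩)⟩, h3⟩
    rw [htri] at hT
    set ν := S.ncard - a with hνdef
    have hrν : r ≤ ν := by
      by_contra hlt
      push Not at hlt
      have h1 : ν * (ν + 1) ≤ (r - 1) * r := by
        have : ν + 1 ≤ r := hlt
        have : ν ≤ r - 1 := by omega
        exact Nat.mul_le_mul (by omega) (by omega)
      omega
    refine ⟨S, hS, hcard, ?_, ?_⟩
    · rw [← ha, ← Nat.cast_add]
      exact_mod_cast (show a + r ≤ S.ncard by omega)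
    · have hempty : {C : Set α | M.IsCircuit C ∧ C.ncard = 3 ∧ ¬ C ⊆ S} = ∅ := by
        rw [Set.eq_empty_iff_forall_notMem]
        rintro C ⟨hC, h3, hCS⟩
        exact hCS (hall C ((hmem𝒯 C).2 ⟨hC, h3⟩))
      rw [hempty, Set.ncard_empty, zero_add]
      -- `r ≤ s₃` from `(r − 1)·r < 2·s₃` alone
      rcases Nat.lt_or_ge r 3 with h3 | h3
      · interval_cases r <;> omega
      · have h2 : 2 * r ≤ (r - 1) * r := Nat.mul_le_mul_right r (by omega)
        omega

end S1

end PercRepro
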